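import Mathlib.Topology.UniformSpace.Ascoli
import Mathlib.Topology.UniformSpace.CompactConvergence
import Mathlib.Topology.MetricSpace.UniformConvergence
import Mathlib.Topology.MetricSpace.Equicontinuity
import Literature.Geometry.Lorentzian.InverseMeanCurvatureFlowMinimizers
import HarnessLib

/-!
# Inverse mean curvature flow I — proofs: extraction of locally uniform limits and the
# normalisation of the subsolution at infinity (Huisken–Ilmanen, proof of Thm. 3.1)

Sorry-free tools for the limiting arguments in the proof of the Weak Existence Theorem 3.1 of
Huisken–Ilmanen (J. Differential Geom. 59 (2001), §3): "By the Arzela–Ascoli theorem, there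
exists `Lᵢ → ∞`, `εᵢ → 0`, a subsequence `uᵢ`, and a locally Lipschitz function `u` such that
`uᵢ → u` locally uniformly on `M ∖ E₀`" (step 1), "Passing `L → ∞` and taking a convergent
subsequence via (3.1)" (step 2), "`u → ∞ as x → ∞`" from `u_L ≥ v` (step 2), and "We may assume
that `E₀ ⊆ F₀`" (before (⋆)_ε). For the level-set formulation of `InverseMeanCurvatureFlow.lean`
(functions on a Riemannian `3`-manifold `X`, locally Lipschitz for the Riemannian distance,
`IsLocLipschitzOn`):

* `exists_tendstoLocallyUniformly_of_equicontinuousOn` — **Arzelà–Ascoli, sequential form, on a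
  weakly locally compact σ-compact space `S`**: a pointwise bounded sequence in `C(S, ℝ)` that is
  equicontinuous on compact sets has a locally uniformly convergent subsequence (Mathlib's
  `ArzelaAscoli.isCompact_closure_of_isClosedEmbedding` for the closed embedding of `C(S, ℝ)`
  into `S →ᵤ[compacts] ℝ` — closed because `C(S, ℝ)` is complete for compact convergence — and
  the metrisability of compact convergence on such `S`);
* `exists_tendstoLocallyUniformlyOn_of_lipschitzOnWith` — **locally equi-Lipschitz sequences on
  a closed set `E ⊆ X` subconverge locally uniformly on `E` to a function locally Lipschitz on
  `E`** (for the Riemannian distance, up to the boundary of `E`), the form in which Arzelà–Ascoli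
  is invoked twice in the proof of Thm. 3.1 with `E = M ∖ E₀`;
* `isCompact_sep_le_of_le` — **properness passes from a proper minorant**: if `v ≤ w` on a closed
  set `E`, `v` is proper with `{v < 0}` precompact and `w` is continuous on `E`, then the sets
  `{x ∈ E | w x ≤ t}` are compact ("`u ≥ v`, hence `u → ∞`");
* `exists_isWeakSubsolutionIVP_closure_subset` — **"We may assume that `E₀ ⊆ F₀`"**: the proper
  weak subsolution `v` of (††) at infinity may be replaced by `v - c`, whose precompact initial
  condition `{v < c}` contains any given compact set, in particular `Ē₀` (translation invariance
  and restriction of subsolutions, `IsWeakSubsolution.add_const`, `.mono`).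

Everything is proved; there are no definitions and no named facts.

## References

* G. Huisken, T. Ilmanen, *The inverse mean curvature flow and the Riemannian Penrose
  inequality*, J. Differential Geom. 59 (2001) 353–437: §3, proof of Thm. 3.1 (the sentence
  "We may assume that `E₀ ⊆ F₀`" before (⋆)_ε; step 1, "By the Arzela–Ascoli theorem …";
  step 2, "`u_L ≥ v` on `F_L`. Passing `L → ∞` and taking a convergent subsequence").
* N. Bourbaki, *General Topology*, Ch. X, §2, no. 5, Thm. 2 (Ascoli).
-/

noncomputable section

open Bundle Set Manifold TopologicalSpace Filter MeasureTheory Function Topology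
open scoped ContDiff Topology ENNReal NNReal Manifold Real UniformConvergence

namespace Literature.Geometry.Lorentzian

open PseudoRiemannianMetric

/-! ### Arzelà–Ascoli: extraction of locally uniformly convergent subsequences -/

section Ascoli

variable {S : Type*} [TopologicalSpace S] [WeaklyLocallyCompactSpace S] [SigmaCompactSpace S]

/-- **Arzelà–Ascoli theorem, sequential form.** On a weakly locally compact, σ-compact space `S`,
a sequence of continuous real functions which is equicontinuous on every compact set and
pointwise bounded has a subsequence converging locally uniformly to a continuous function.
(The closure of the sequence in `C(S, ℝ)` with the topology of compact convergence is compact by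
Ascoli's theorem, and that topology is metrisable on such `S`.) Bourbaki, *General Topology*,
X, §2, no. 5, Thm. 2; this is the form used by Huisken–Ilmanen in the proof of Thm. 3.1 ("By the
Arzela–Ascoli theorem, there exists … a subsequence `uᵢ` … such that `uᵢ → u` locally
uniformly"). [folklore] -/
theorem exists_tendstoLocallyUniformly_of_equicontinuousOn (U : ℕ → C(S, ℝ))
    (heq : ∀ K : Set S, IsCompact K → EquicontinuousOn (fun i ↦ ⇑(U i)) K)
    (hbd : ∀ x : S, ∃ B : ℝ, ∀ i, |U i x| ≤ B) :
    ∃ (w : C(S, ℝ)) (φ : ℕ → ℕ), StrictMono φ ∧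
      TendstoLocallyUniformly (fun i ↦ ⇑(U (φ i))) w atTop := by
  -- the closed embedding of `C(S, ℝ)` into `S →ᵤ[compacts] ℝ`
  have hcov : ⋃₀ {K : Set S | IsCompact K} = univ :=
    eq_univ_of_forall fun x ↦ mem_sUnion_of_mem (mem_singleton x) isCompact_singleton
  haveI : T2Space (S →ᵤ[{K : Set S | IsCompact K}] ℝ) := UniformOnFun.t2Space_of_covering hcov
  have h1 : IsUniformEmbedding
      (ContinuousMap.toUniformOnFunIsCompact : C(S, ℝ) → S →ᵤ[{K : Set S | IsCompact K}] ℝ) :=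
    ContinuousMap.isUniformEmbedding_toUniformOnFunIsCompact
  have h2 : IsClosed (range
      (ContinuousMap.toUniformOnFunIsCompact : C(S, ℝ) → S →ᵤ[{K : Set S | IsCompact K}] ℝ)) :=
    ((completeSpace_iff_isComplete_range h1.isUniformInducing).1 inferInstance).isClosed
  have hemb : IsClosedEmbedding
      (UniformOnFun.ofFun {K : Set S | IsCompact K} ∘ fun f : C(S, ℝ) ↦ (⇑f : S → ℝ)) :=
    ⟨h1.isEmbedding, h2⟩
  -- Ascoli
  have hcpt : IsCompact (closure (range U)) := by
    refine ArzelaAscoli.isCompact_closure_of_isClosedEmbedding (ι := C(S, ℝ))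
      (F := fun f : C(S, ℝ) ↦ (⇑f : S → ℝ)) (𝔖 := {K : Set S | IsCompact K}) (fun K hK ↦ hK)
      hemb (s := range U) (fun K hK ↦ ?_) (fun K _ x _ ↦ ?_)
    · intro x₀ hx₀ V hV
      filter_upwards [heq K hK x₀ hx₀ V hV] with x hx ⟨g, n, hn⟩
      simp only [comp_apply, ← hn]
      exact hx n
    · obtain ⟨B, hB⟩ := hbd x
      refine ⟨Icc (-B) B, isCompact_Icc, ?_⟩
      rintro _ ⟨n, rfl⟩
      exact abs_le.1 (hB n)
  obtain ⟨w, -, φ, hφ, hw⟩ := hcpt.tendsto_subseq fun n ↦ subset_closure (mem_range_self n)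
  exact ⟨w, φ, hφ, ContinuousMap.tendsto_iff_tendstoLocallyUniformly.1 hw⟩

end Ascoli

variable {X : Type*} [TopologicalSpace X] [ChartedSpace E3 X] [IsManifold (𝓡 3) ∞ X]

/-! ### Locally equi-Lipschitz sequences on a closed set subconverge -/

section Lipschitz

variable (h : ContMDiffRiemannianMetric (𝓡 3) ∞ E3 (TangentSpace (𝓡 3) : X → Type _))
  [T2Space X] [LocallyCompactSpace X] [SecondCountableTopology X]

/-- **Locally equi-Lipschitz, pointwise bounded sequences subconverge locally uniformly.** Let
`E ⊆ X` be closed and `u : ℕ → X → ℝ` a sequence which near every point of `E` is Lipschitz on a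
relative neighbourhood in `E`, for the Riemannian distance, with a constant independent of `i`
(locally equi-Lipschitz on `E` up to its boundary), and which is bounded at every point of `E`.
Then a subsequence converges locally uniformly on `E` to a function `w` locally Lipschitz on `E`
(with the same local constants). Arzelà–Ascoli (`exists_tendstoLocallyUniformly_of_equicontinuousOn`
on the closed, hence locally compact σ-compact, subspace `E`); Lipschitz bounds pass to pointwise
limits. This is the extraction "`uᵢ → u` locally uniformly on `M ∖ E₀`, `u` locally Lipschitz" of
the proof of Thm. 3.1 (steps 1 and 2, `E = M ∖ E₀`, the bounds coming from (3.1) and (3.7)).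
[cite: HuiskenIlmanenIMCF2001, proof of Thm. 3.1 step 1 ("By the Arzela–Ascoli theorem")] -/
theorem exists_tendstoLocallyUniformlyOn_of_lipschitzOnWith {E : Set X} (hE : IsClosed E)
    (u : ℕ → X → ℝ)
    (hlip : ∀ x ∈ E, ∃ (K : ℝ≥0) (t : Set X), t ∈ 𝓝[E] x ∧ ∀ i,
      letI : RiemannianBundle (fun x : X ↦ TangentSpace (𝓡 3) x) :=
        ⟨h.toContinuousRiemannianMetric.toRiemannianMetric⟩
      letI : PseudoEMetricSpace X := .ofRiemannianMetric (𝓡 3) X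
      LipschitzOnWith K (u i) t)
    (hbd : ∀ x ∈ E, ∃ B : ℝ, ∀ i, |u i x| ≤ B) :
    ∃ (w : X → ℝ) (φ : ℕ → ℕ), StrictMono φ ∧ IsLocLipschitzOn h w E ∧
      TendstoLocallyUniformlyOn (fun i ↦ u (φ i)) w atTop E := by
  classical
  letI : RiemannianBundle (fun x : X ↦ TangentSpace (𝓡 3) x) :=
    ⟨h.toContinuousRiemannianMetric.toRiemannianMetric⟩
  letI : PseudoEMetricSpace X := .ofRiemannianMetric (𝓡 3) X
  haveI : LocallyCompactSpace E := hE.locallyCompactSpace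
  haveI : SigmaCompactSpace E := hE.sigmaCompactSpace
  -- equicontinuity of the restrictions to the subspace `E`
  have hEq : Equicontinuous fun i (q : E) ↦ u i q := by
    intro p
    obtain ⟨K, t, ht, hK⟩ := hlip p p.2
    have hpt : (p : X) ∈ t := mem_of_mem_nhdsWithin p.2 ht
    have h1 : EquicontinuousWithinAt (fun i ↦ u i) t (p : X) :=
      (LipschitzOnWith.uniformEquicontinuousOn (fun i ↦ u i) K hK).equicontinuousOn (p : X) hpt
    intro V hV
    have h2 : ∀ᶠ y in 𝓝[E] (p : X), ∀ i, (u i p, u i y) ∈ V :=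
      (h1 V hV).filter_mono (nhdsWithin_le_iff.2 ht)
    rw [← map_nhds_subtype_val, eventually_map] at h2
    exact h2
  -- the continuous restrictions and Arzelà–Ascoli
  set U : ℕ → C(E, ℝ) := fun i ↦ ⟨fun q ↦ u i q,
    continuous_iff_continuousAt.2 fun p ↦ (hEq p).continuousAt i⟩ with hU
  obtain ⟨w, φ, hφ, hw⟩ := exists_tendstoLocallyUniformly_of_equicontinuousOn U
    (fun K _ ↦ hEq.equicontinuousOn K) (fun q ↦ hbd q q.2)
  -- the limit, extended by `0` off `E`
  set W : X → ℝ := fun x ↦ if hx : x ∈ E then w ⟨x, hx⟩ else 0 with hW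
  have hWw : (W ∘ ((↑) : E → X)) = w := by
    funext q
    simp only [comp_apply, hW, dif_pos q.2]
  have hconv : TendstoLocallyUniformlyOn (fun i ↦ u (φ i)) W atTop E := by
    rw [tendstoLocallyUniformlyOn_iff_tendstoLocallyUniformly_comp_coe, hWw]
    exact hw
  refine ⟨W, φ, hφ, ?_, hconv⟩
  -- the limit is locally Lipschitz on `E` with the same local constants
  change LocallyLipschitzOn E W
  intro x hx
  obtain ⟨K, t, ht, hK⟩ := hlip x hx
  refine ⟨K, t ∩ E, inter_mem ht self_mem_nhdsWithin, fun a ha b hb ↦ ?_⟩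
  have ha' := hconv.tendsto_at ha.2
  have hb' := hconv.tendsto_at hb.2
  exact le_of_tendsto' (ha'.edist hb') fun i ↦ hK (φ i) ha.1 hb.1

end Lipschitz

/-! ### Properness of the limit from a proper minorant -/

section Proper

omit [ChartedSpace E3 X] [IsManifold (𝓡 3) ∞ X] in
/-- **A continuous function above a proper function has compact sublevel sets.** If `v` is proper
(`{s ≤ v ≤ t}` compact) with `{v < 0}` precompact, and `v ≤ w` on a closed set `E` on
which `w` is continuous, then each `{x ∈ E | w x ≤ t}` is compact — it is closed and contained in
`{v ≤ t} ⊆ closure {v < 0} ∪ {0 ≤ v ≤ t}`. This is "`u_L ≥ v` on `F_L` … `u ≥ v`", whence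
`u → ∞` and the solution is proper, in the proof of Thm. 3.1, step 2.
[cite: HuiskenIlmanenIMCF2001, proof of Thm. 3.1 step 2] -/
theorem isCompact_sep_le_of_le {E : Set X} (hE : IsClosed E) {v w : X → ℝ} (hp : IsProperFun v)
    (h0 : IsCompact (closure {x | v x < 0})) (hwc : ContinuousOn w E)
    (hle : ∀ x ∈ E, v x ≤ w x) (t : ℝ) : IsCompact {x | x ∈ E ∧ w x ≤ t} := by
  have hcl : IsClosed {x | x ∈ E ∧ w x ≤ t} := by
    change IsClosed (E ∩ w ⁻¹' Iic t)
    exact hwc.preimage_isClosed_of_isClosed hE isClosed_Iic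
  refine (h0.union (hp 0 t)).of_isClosed_subset hcl fun x hx ↦ ?_
  by_cases hx0 : v x < 0
  · exact Or.inl (subset_closure hx0)
  · exact Or.inr ⟨not_lt.1 hx0, (hle x hx.1).trans hx.2⟩

end Proper

/-! ### Normalisation of the subsolution at infinity: "We may assume that `E₀ ⊆ F₀`" -/

section Normalise

variable (h : ContMDiffRiemannianMetric (𝓡 3) ∞ E3 (TangentSpace (𝓡 3) : X → Type _))
  [T2Space X] [LocallyCompactSpace X] [MeasurableSpace X] [BorelSpace X]
  [SecondCountableTopology X]

/-- **Shifting a subsolution of (††).** If `v` is a proper weak subsolution of (††) with initial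
condition `F₀ = {v < 0}` and `0 ≤ c`, then `v - c` is a proper weak subsolution of (††) with the
precompact initial condition `F_c = {v < c} ⊇ F₀` (translation invariance of (1.5),
`IsWeakSubsolution.add_const`, and restriction to the open set `X ∖ F̄_c ⊆ X ∖ F̄₀`).
[cite: HuiskenIlmanenIMCF2001, proof of Thm. 3.1 ("We may assume that E₀ ⊆ F₀")] -/
theorem IsWeakSubsolutionIVP.sub_const {v : X → ℝ} {F₀ : Set X} (hv : IsWeakSubsolutionIVP h v F₀)
    (hp : IsProperFun v) (hF₀ : IsCompact (closure F₀)) {c : ℝ} (hc : 0 ≤ c) :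
    IsProperFun (fun x ↦ v x - c) ∧ IsCompact (closure {x | v x < c}) ∧
      IsWeakSubsolutionIVP h (fun x ↦ v x - c) {x | v x < c} := by
  have hvc : Continuous v := hv.continuous h
  refine ⟨fun s t ↦ ?_, ?_, ?_, ?_, ?_⟩
  · have : (fun x ↦ v x - c) ⁻¹' Icc s t = v ⁻¹' Icc (s + c) (t + c) := by
      ext x; simp only [mem_preimage, mem_Icc]; constructor <;> intro hx <;> constructor <;>
        linarith [hx.1, hx.2]
    rw [this]
    exact hp _ _
  · exact isCompact_closure_setOf_lt_of_isProperFun hp hvc (hv.2.1 ▸ hF₀) c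
  · simpa only [sub_eq_add_neg] using hv.1.add_const h (-c)
  · ext x
    simp only [mem_setOf_eq, sub_neg]
  · have hsub : IsWeakSubsolution h v (closure {x | v x < c})ᶜ :=
      hv.isWeakSubsolution_compl_closure_setOf_lt h hc
    simpa only [sub_eq_add_neg] using hsub.add_const h isClosed_closure.isOpen_compl (-c)

/-- **"We may assume that `E₀ ⊆ F₀`."** Given a proper weak subsolution of (††) with precompact
initial condition and a set `E₀` with compact closure, there is a proper weak subsolution of (††)
whose precompact initial condition contains `Ē₀` (shift `v` by a constant exceeding `max_{Ē₀} v`).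
This is the normalisation made at the start of the proof of Thm. 3.1, under which the Comparison
Theorem 2.2 (ii) applies to `E₀` and the sublevel sets `F_t` of the subsolution.
[cite: HuiskenIlmanenIMCF2001, proof of Thm. 3.1 ("We may assume that E₀ ⊆ F₀")] -/
theorem exists_isWeakSubsolutionIVP_closure_subset
    (hsub : ∃ (v : X → ℝ) (F₀ : Set X), IsProperFun v ∧ IsCompact (closure F₀) ∧
      IsWeakSubsolutionIVP h v F₀)
    {E₀ : Set X} (hE₀ : IsCompact (closure E₀)) :
    ∃ (v : X → ℝ) (F₀ : Set X), IsProperFun v ∧ IsCompact (closure F₀) ∧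
      IsWeakSubsolutionIVP h v F₀ ∧ closure E₀ ⊆ F₀ := by
  obtain ⟨v, F₀, hp, hF₀, hv⟩ := hsub
  have hvc : Continuous v := hv.continuous h
  obtain ⟨B, hB⟩ := (hE₀.image hvc).isBounded.bddAbove
  set c : ℝ := max B 0 + 1 with hc
  have hc0 : 0 ≤ c := by rw [hc]; positivity
  obtain ⟨hp', hF', hv'⟩ := hv.sub_const h hp hF₀ hc0
  refine ⟨fun x ↦ v x - c, {x | v x < c}, hp', hF', hv', fun x hx ↦ ?_⟩
  have : v x ≤ B := hB (mem_image_of_mem v hx)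
  show v x < c
  rw [hc]
  linarith [le_max_left B 0]

end Normalise

end Literature.Geometry.Lorentzian

end
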